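import Summits.Ventures.GridStability.Lyapunov.StructurePreservingCrossTerm
import HarnessLib

/-!
# GridStability/Lyapunov/StructurePreservingRate — the solver-free EXPONENTIAL RATE inequality
# `V̇_h ≤ −ρ·V_h` for the strict Lyapunov function `V_h = V + hX` of the mixed-order
# structure-preserving class, with `ρ` in closed form (leaf Poincaré bound + sector gain)

Cell `gridfusion` (LADDER-GRIDFUSION), seat gridfusion-lyap-1 (g7); brief «SP-RATE» = the successor plan
left by g6 in HANDOFF § «lyap-1 g6 — FINAL» on its groundwork `StructurePreservingCrossTerm.lean`
(p542074: the cross term `X = Σ_gen Mᵢωᵢφᵢ + ½Σ Dᵢφᵢ²`, `Ẋ = 2K − Π`, `V_h = V + hX`,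
`V̇_h = −Σ_load Dᵢδ̇ᵢ² − Σ_gen (Dᵢ − hMᵢ)ωᵢ² − hΠ`, `vh_eq`). MODEL MV-3 (model-2's
`StructurePreserving.Params`: generator nodes second order, load buses first order, EVERY node damped,
ANY damping pattern, ANY symmetric susceptive coupling graph; `gen = univ` = the network-reduced classical
model with non-uniform damping) in the frame rotating at `ω₀` (`phaseField`, powers `P̄`).

WHAT IS PROVED (everything; no named fact; one closed-form definition `vhRate`). With
`φ = δ − δ₀`, `K = ½Σ_gen Mᵢωᵢ²`, the quadratic comparison form `Q = ½ΣᵢΣⱼ bᵢⱼ(Δσᵢⱼ)²/2` of model-2's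
`StructurePreservingEnergy` (written out, no definition), `Φ = Σᵢ Dᵢφᵢ²`, the uniform sector gain
`g(θ) = (1 − sin θ)/(π/2 − θ)` [cite: VuTuritsyn2017, §IV-A], `SD = Σᵢ Dᵢ`, `SM = Σ_gen Mᵢ`, a coupling
lower bound `β ≤ bᵢⱼ` on the edges of the (preconnected) coupling graph:

* `pairing_ge_quadratic` — `Π(δ) ≥ 2g(θ)·Q` on the closed window `|σᵢⱼ| ≤ π/2` (equilibrium line
  angles `|σ*| ≤ θ < π/2`): lit-1's strict sector bound `strictSector_lower` edge by edge;
* `sum_D_sq_le_of_mem_constraintSet` — the **leaf Poincaré bound**: on the momentum leaf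
  `{L(δ, ω) = L(δ₀, 0)}` (`constraintSet`), `Φ ≤ (4n²·SD/β)·Q + (2·SM/SD)·K` — the only place where the
  absolute deviations `φᵢ` (which `V_h` sees) are controlled by the line deviations `Δσ` (which the
  dissipation sees): model-2's walk telescoping `abs_sub_le_card_mul` for `φᵢ − φ̄`, and Cauchy–Schwarz
  on the momentum constraint `SD·φ̄ = −Σ_gen Mᵢωᵢ` for the D-weighted mean `φ̄`;
* `vh_le_of_two_mul_le` — `V_h ≤ 2K + hΦ + Q` for `0 ≤ h`, `2hMᵢ ≤ Dᵢ` on the generators (`vh_eq`,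
  `(a + b)² ≤ 2a² + 2b²`, `W ≤ Q`);
* `vhRate p β θ h = min{ h/(1 + h·SM/SD), 2h·g(θ)/(1 + 4h·n²·SD/β) }` and **`fderiv_vh_le_neg_vhRate_mul`**:
  for `0 < h`, `2hMᵢ ≤ Dᵢ` on the generators, at every phase point of the closed window on the momentum
  leaf, `DV_h(x)·F(x) ≤ −vhRate·V_h(x)` — the pointwise exponential-rate inequality, SOLVER-FREE and
  INVERSE-FREE, for every `n`, every coupling graph and every damping pattern.

The packaging along solutions (on the certified region of record `{V ≤ c < c⋆(θ, β)} ∩ window ∩ leaf`: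
`V_h(t) ≤ V_h(0)e^{−ρt}`, `K ≤ 2V_h`, `V ≤ 3V_h`, `V(t) ≤ 3C·V(0)e^{−ρt}`) is the sibling
`StructurePreservingRateRoa.lean`.
THREE COLUMNS: mathematics about MODEL MV-3; `ρ` is a certified LOWER bound on the decay rate of `V_h`
in the model (the `n²` walk constant makes it small on large networks — a theorem about the class, never
a damping figure for any grid); no certificate data; no sentence says a grid is stable. Standard axioms.
-/

noncomputable section

open Set Filter Topology Real Finset
open Summit.Ventures.GridStability.Models.StructurePreserving
open Summit.Ventures.GridStability.Models.StructurePreserving.Params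
open Literature.MathematicalPhysics.PowerSystems (SinusoidalCoupling.strictSector_lower
  SinusoidalCoupling.sectorGain_antitone SinusoidalCoupling.sectorGain_pos)

namespace Summit.Ventures.GridStability.Lyapunov.StructurePreserving

variable {n : ℕ}

/-! ### The pairing form dominates the quadratic comparison form on the window -/

/-- **`Π ≥ 2g(θ)·Q` on the closed window.** For susceptive couplings `bᵢⱼ ≥ 0`, equilibrium line
angles `|δ₀ᵢ − δ₀ⱼ| ≤ θ` (`0 ≤ θ < π/2`) and current line angles `|δᵢ − δⱼ| ≤ π/2` on coupled pairs,
`2·g(θ)·(½ΣᵢΣⱼ bᵢⱼ(Δσᵢⱼ)²/2) ≤ Π(δ) = ½ΣᵢΣⱼ bᵢⱼ Δσᵢⱼ(sin σᵢⱼ − sin σ*ᵢⱼ)`: edge by edge the strict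
sector bound `g(σ*)·(σ − σ*)² ≤ (σ − σ*)(sin σ − sin σ*)` (lit-1 `strictSector_lower`) and
`g(θ) ≤ g(σ*)` (`sectorGain_antitone`). [cite: VuTuritsyn2017, §IV-A (strict sector bound)] -/
theorem pairing_ge_quadratic (p : Params n) (hb : ∀ i j, 0 ≤ p.b i j) {δ₀ δ : Fin n → ℝ}
    {θ : ℝ} (hθ : θ < π / 2)
    (h0 : ∀ i j, p.b i j ≠ 0 → |δ₀ i - δ₀ j| ≤ θ)
    (hP : ∀ i j, p.b i j ≠ 0 → |δ i - δ j| ≤ π / 2) :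
    2 * ((1 - Real.sin θ) / (π / 2 - θ))
        * ((1 / 2) * ∑ i, ∑ j, p.b i j * (((δ i - δ j) - (δ₀ i - δ₀ j)) ^ 2 / 2))
      ≤ pairing p δ₀ δ := by
  set gθ := (1 - Real.sin θ) / (π / 2 - θ) with hgθ
  have hterm : ∀ i j, gθ * (p.b i j * ((δ i - δ j) - (δ₀ i - δ₀ j)) ^ 2)
      ≤ p.b i j * (((δ i - δ j) - (δ₀ i - δ₀ j))
        * (Real.sin (δ i - δ j) - Real.sin (δ₀ i - δ₀ j))) := by
    intro i j
    by_cases hij : p.b i j = 0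
    · simp [hij]
    · have h0ij : |δ₀ i - δ₀ j| < π / 2 := (h0 i j hij).trans_lt hθ
      have hga : gθ ≤ (1 - Real.sin |δ₀ i - δ₀ j|) / (π / 2 - |δ₀ i - δ₀ j|) :=
        SinusoidalCoupling.sectorGain_antitone (abs_nonneg _) (h0 i j hij) hθ
      have hs := SinusoidalCoupling.strictSector_lower h0ij (hP i j hij)
      have hsq : 0 ≤ ((δ i - δ j) - (δ₀ i - δ₀ j)) ^ 2 := sq_nonneg _
      calc gθ * (p.b i j * ((δ i - δ j) - (δ₀ i - δ₀ j)) ^ 2)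
          = p.b i j * (gθ * ((δ i - δ j) - (δ₀ i - δ₀ j)) ^ 2) := by ring
        _ ≤ p.b i j * ((1 - Real.sin |δ₀ i - δ₀ j|) / (π / 2 - |δ₀ i - δ₀ j|)
              * ((δ i - δ j) - (δ₀ i - δ₀ j)) ^ 2) :=
            mul_le_mul_of_nonneg_left (mul_le_mul_of_nonneg_right hga hsq) (hb i j)
        _ ≤ p.b i j * (((δ i - δ j) - (δ₀ i - δ₀ j))
              * (Real.sin (δ i - δ j) - Real.sin (δ₀ i - δ₀ j))) :=
            mul_le_mul_of_nonneg_left hs (hb i j)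
  have hL : 2 * gθ * ((1 / 2) * ∑ i, ∑ j, p.b i j * (((δ i - δ j) - (δ₀ i - δ₀ j)) ^ 2 / 2))
      = (1 / 2) * ∑ i, ∑ j, gθ * (p.b i j * ((δ i - δ j) - (δ₀ i - δ₀ j)) ^ 2) := by
    simp only [Finset.mul_sum]
    exact Finset.sum_congr rfl fun i _ => Finset.sum_congr rfl fun j _ => by ring
  rw [hL]
  unfold pairing
  exact mul_le_mul_of_nonneg_left
    (Finset.sum_le_sum fun i _ => Finset.sum_le_sum fun j _ => hterm i j) (by norm_num)

/-! ### The leaf Poincaré bound -/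

/-- A single coupled edge deviation is controlled by the comparison form: for `β ≤ bᵤᵥ` (`β > 0`,
`b ≥ 0`), `(φᵤ − φᵥ)² ≤ 4Q/β` with `φ = δ − δ₀` (model-2's `branch_sq_le_quadraticGap`). [folklore] -/
theorem edge_sq_le_of_le_coupling (p : Params n) (hb : ∀ i j, 0 ≤ p.b i j) {β : ℝ} (hβ : 0 < β)
    (δ₀ δ : Fin n → ℝ) {u v : Fin n} (hβb : β ≤ p.b u v) :
    ((δ u - δ₀ u) - (δ v - δ₀ v)) ^ 2
      ≤ 4 * ((1 / 2) * ∑ a, ∑ c, p.b a c * (((δ a - δ c) - (δ₀ a - δ₀ c)) ^ 2 / 2)) / β := by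
  have h1 := p.branch_sq_le_quadraticGap hb δ₀ δ u v
  have hid : (δ u - δ₀ u) - (δ v - δ₀ v) = (δ u - δ v) - (δ₀ u - δ₀ v) := by ring
  rw [hid, le_div_iff₀ hβ]
  have hsq : 0 ≤ ((δ u - δ v) - (δ₀ u - δ₀ v)) ^ 2 := sq_nonneg _
  nlinarith [mul_le_mul_of_nonneg_left hβb hsq]

/-- **The leaf Poincaré bound.** Well-formed data on `n ≠ 0` buses, susceptive couplings `bᵢⱼ ≥ 0`
with `bᵢⱼ ≥ β > 0` on the edges of a PRECONNECTED coupling graph. On the momentum leaf through the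
equilibrium (`L(δ, ω) = L(δ₀, 0)`, the first conjunct of `constraintSet`) the D-weighted squared angle
deviation is controlled by the line deviations and the kinetic energy:
`Σᵢ Dᵢφᵢ² ≤ (4n²·ΣD/β)·Q + (2·Σ_gen M/ΣD)·K`, `φ = δ − δ₀`, `Q = ½ΣᵢΣⱼ bᵢⱼ(Δσᵢⱼ)²/2`,
`K = ½Σ_gen Mᵢωᵢ²`. Proof: `Σ Dᵢφᵢ² = Σ Dᵢ(φᵢ − φ̄)² + ΣD·φ̄²` with `φ̄ = Σ Dⱼφⱼ/ΣD`; every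
`|φᵢ − φ̄| ≤ max_j |φᵢ − φⱼ| ≤ n·√(4Q/β)` (edge bound + model-2's walk telescoping
`abs_sub_le_card_mul`); and the leaf pins `ΣD·φ̄ = −Σ_gen Mⱼωⱼ`, so `(ΣD·φ̄)² ≤ (Σ_gen M)(2K)`
(Cauchy–Schwarz). [folklore] -/
theorem sum_D_sq_le_of_mem_constraintSet {p : Params n} (hp : p.WellFormed) (hn : n ≠ 0)
    (hconn : p.couplingGraph.Preconnected) (hb : ∀ i j, 0 ≤ p.b i j) {β : ℝ} (hβ : 0 < β)
    (hβb : ∀ i j, p.couplingGraph.Adj i j → β ≤ p.b i j)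
    {δ₀ : Fin n → ℝ} {x : (Fin n → ℝ) × (Fin n → ℝ)} (hx : x ∈ constraintSet p δ₀) :
    ∑ i, p.D i * (x.1 i - δ₀ i) ^ 2
      ≤ 4 * (n : ℝ) ^ 2 * (∑ i, p.D i) / β
          * ((1 / 2) * ∑ i, ∑ j, p.b i j * (((x.1 i - x.1 j) - (δ₀ i - δ₀ j)) ^ 2 / 2))
        + 2 * (∑ i ∈ p.gen, p.M i) / (∑ i, p.D i) * p.kinetic x.2 := by
  set φ : Fin n → ℝ := fun i => x.1 i - δ₀ i with hφ
  set SD : ℝ := ∑ i, p.D i with hSD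
  set Qx : ℝ := (1 / 2) * ∑ i, ∑ j, p.b i j * (((x.1 i - x.1 j) - (δ₀ i - δ₀ j)) ^ 2 / 2)
    with hQx
  have hSDpos : 0 < SD := sum_D_pos hp hn
  have hQ0 : 0 ≤ Qx := p.quadraticGap_nonneg hb δ₀ x.1
  -- (1) edgewise bound and telescoping
  set ε : ℝ := Real.sqrt (4 * Qx / β) with hε
  have hεnn : 0 ≤ ε := Real.sqrt_nonneg _
  have hε2 : ε ^ 2 = 4 * Qx / β := Real.sq_sqrt (by positivity)
  have hedge : ∀ u v, p.couplingGraph.Adj u v → |φ u - φ v| ≤ ε := by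
    intro u v huv
    have h := edge_sq_le_of_le_coupling p hb hβ δ₀ x.1 (hβb u v huv)
    exact Real.abs_le_sqrt (by simpa only [hφ] using h)
  have hpair : ∀ i j, |φ i - φ j| ≤ n * ε := fun i j => p.abs_sub_le_card_mul hconn hεnn hedge i j
  -- (2) the D-weighted mean `s/SD`, `s = Σ Dφ`
  set s : ℝ := ∑ j, p.D j * φ j with hs
  have hdev : ∀ i, |φ i - s / SD| ≤ n * ε := fun i => by
    have hmul : SD * (φ i - s / SD) = ∑ j, p.D j * (φ i - φ j) := by
      have : SD * (φ i - s / SD) = SD * φ i - s := by field_simp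
      rw [this, hSD, hs, Finset.sum_mul, ← Finset.sum_sub_distrib]
      exact Finset.sum_congr rfl fun j _ => by ring
    have habs : SD * |φ i - s / SD| ≤ SD * (n * ε) := by
      rw [← abs_of_pos hSDpos, ← abs_mul, abs_of_pos hSDpos, hmul]
      refine (Finset.abs_sum_le_sum_abs _ _).trans ?_
      rw [hSD, Finset.sum_mul]
      refine Finset.sum_le_sum fun j _ => ?_
      rw [abs_mul, abs_of_pos (hp.D_pos j)]
      exact mul_le_mul_of_nonneg_left (hpair i j) (hp.D_pos j).le
    exact le_of_mul_le_mul_left habs hSDpos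
  have hdev2 : ∀ i, (φ i - s / SD) ^ 2 ≤ (n : ℝ) ^ 2 * (4 * Qx / β) := fun i => by
    have h1 : (φ i - s / SD) ^ 2 ≤ (n * ε) ^ 2 := by
      have := hdev i
      have hnε : 0 ≤ (n : ℝ) * ε := by positivity
      exact sq_le_sq' (by linarith [(abs_le.1 this).1]) (abs_le.1 this).2
    calc (φ i - s / SD) ^ 2 ≤ (n * ε) ^ 2 := h1
      _ = (n : ℝ) ^ 2 * ε ^ 2 := by ring
      _ = (n : ℝ) ^ 2 * (4 * Qx / β) := by rw [hε2]
  -- (3) the variance identity `Σ Dφ² = Σ D(φ − s/SD)² + s²/SD`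
  have hvar : ∑ i, p.D i * φ i ^ 2 = ∑ i, p.D i * (φ i - s / SD) ^ 2 + s ^ 2 / SD := by
    have hexp : ∑ i, p.D i * (φ i - s / SD) ^ 2
        = ∑ i, p.D i * φ i ^ 2 - 2 * (s / SD) * ∑ i, p.D i * φ i + (s / SD) ^ 2 * ∑ i, p.D i := by
      rw [Finset.mul_sum, Finset.mul_sum, ← Finset.sum_sub_distrib, ← Finset.sum_add_distrib]
      exact Finset.sum_congr rfl fun i _ => by ring
    rw [hexp, ← hs, ← hSD]
    field_simp
    ring
  -- (4) the variance part
  have hvarbd : ∑ i, p.D i * (φ i - s / SD) ^ 2 ≤ SD * ((n : ℝ) ^ 2 * (4 * Qx / β)) := by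
    rw [hSD, Finset.sum_mul]
    exact Finset.sum_le_sum fun i _ => mul_le_mul_of_nonneg_left (hdev2 i) (hp.D_pos i).le
  -- (5) the mean part: the leaf pins `s = −Σ_gen Mω`, Cauchy–Schwarz
  have hmom : s = -∑ j ∈ p.gen, p.M j * x.2 j := by
    have hL := hx.1
    unfold Params.momentum at hL
    simp only [Pi.zero_apply, mul_zero, Finset.sum_const_zero, zero_add] at hL
    have hsplit : ∑ j, p.D j * x.1 j - ∑ j, p.D j * δ₀ j = s := by
      rw [hs, ← Finset.sum_sub_distrib]
      exact Finset.sum_congr rfl fun j _ => by simp only [hφ]; ring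
    linarith
  have hCS : s ^ 2 ≤ (∑ j ∈ p.gen, p.M j) * (2 * p.kinetic x.2) := by
    rw [hmom, neg_sq]
    have h := Finset.sum_sq_le_sum_mul_sum_of_sq_le_mul p.gen
      (r := fun j => p.M j * x.2 j) (f := fun j => p.M j) (g := fun j => p.M j * x.2 j ^ 2)
      (fun j hj => (hp.M_pos j hj).le)
      (fun j hj => mul_nonneg (hp.M_pos j hj).le (sq_nonneg _))
      (fun j _ => by ring_nf; exact le_rfl)
    have hK : 2 * p.kinetic x.2 = ∑ j ∈ p.gen, p.M j * x.2 j ^ 2 := by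
      unfold Params.kinetic; ring
    rw [hK]
    exact h
  have hmean : s ^ 2 / SD ≤ 2 * (∑ i ∈ p.gen, p.M i) / SD * p.kinetic x.2 := by
    rw [div_le_iff₀ hSDpos]
    have : 2 * (∑ i ∈ p.gen, p.M i) / SD * p.kinetic x.2 * SD
        = (∑ j ∈ p.gen, p.M j) * (2 * p.kinetic x.2) := by
      field_simp
    rw [this]
    exact hCS
  -- (6) assemble
  have hmain : ∑ i, p.D i * φ i ^ 2
      ≤ SD * ((n : ℝ) ^ 2 * (4 * Qx / β)) + 2 * (∑ i ∈ p.gen, p.M i) / SD * p.kinetic x.2 := by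
    rw [hvar]
    exact add_le_add hvarbd hmean
  have hrew : SD * ((n : ℝ) ^ 2 * (4 * Qx / β)) = 4 * (n : ℝ) ^ 2 * SD / β * Qx := by
    field_simp
  rw [hrew] at hmain
  simpa only [hφ, hSD, hQx] using hmain

/-! ### Upper bound of the strict Lyapunov function -/

/-- **`V_h ≤ 2K + h·Σ Dᵢφᵢ² + Q`** for `0 ≤ h` with `2hMᵢ ≤ Dᵢ` on the generators (well-formed data,
`bᵢⱼ ≥ 0`): from the completed square `vh_eq`, `(ω + hφ)² ≤ 2ω² + 2h²φ²`, `h²Mᵢ ≤ hDᵢ/2`, `Dᵢ − hMᵢ ≤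
Dᵢ` and model-2's `W ≤ Q` (`potential_le_quadratic`). [folklore] -/
theorem vh_le_of_two_mul_le {p : Params n} (hp : p.WellFormed) (hb : ∀ i j, 0 ≤ p.b i j)
    (δ₀ : Fin n → ℝ) {h : ℝ} (hh : 0 ≤ h) (hhM : ∀ i ∈ p.gen, 2 * h * p.M i ≤ p.D i)
    (x : (Fin n → ℝ) × (Fin n → ℝ)) :
    phaseEnergy p δ₀ x + h * crossTerm p δ₀ x
      ≤ 2 * p.kinetic x.2 + h * ∑ i, p.D i * (x.1 i - δ₀ i) ^ 2
        + (1 / 2) * ∑ i, ∑ j, p.b i j * (((x.1 i - x.1 j) - (δ₀ i - δ₀ j)) ^ 2 / 2) := by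
  rw [vh_eq hp δ₀ h x]
  have hW := p.potential_le_quadratic δ₀ x.1 hb
  -- generator square: ½M(ω+hφ)² ≤ Mω² + h²Mφ² ≤ Mω² + (h/2)Dφ²
  have hT1 : (1 / 2) * ∑ i ∈ p.gen, p.M i * (x.2 i + h * (x.1 i - δ₀ i)) ^ 2
      ≤ 2 * p.kinetic x.2 + (h / 2) * ∑ i ∈ p.gen, p.D i * (x.1 i - δ₀ i) ^ 2 := by
    have hterm : ∀ i ∈ p.gen, (1 / 2) * (p.M i * (x.2 i + h * (x.1 i - δ₀ i)) ^ 2)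
        ≤ p.M i * x.2 i ^ 2 + (h / 2) * (p.D i * (x.1 i - δ₀ i) ^ 2) := by
      intro i hi
      have hMi := (hp.M_pos i hi).le
      have hsq : (x.2 i + h * (x.1 i - δ₀ i)) ^ 2
          ≤ 2 * x.2 i ^ 2 + 2 * (h ^ 2 * (x.1 i - δ₀ i) ^ 2) := by
        nlinarith [sq_nonneg (x.2 i - h * (x.1 i - δ₀ i))]
      have hφ2 : 0 ≤ (x.1 i - δ₀ i) ^ 2 := sq_nonneg _
      have hhM2 : h ^ 2 * p.M i ≤ h * p.D i / 2 := by nlinarith [hhM i hi]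
      calc (1 / 2) * (p.M i * (x.2 i + h * (x.1 i - δ₀ i)) ^ 2)
          ≤ (1 / 2) * (p.M i * (2 * x.2 i ^ 2 + 2 * (h ^ 2 * (x.1 i - δ₀ i) ^ 2))) :=
            mul_le_mul_of_nonneg_left (mul_le_mul_of_nonneg_left hsq hMi) (by norm_num)
        _ = p.M i * x.2 i ^ 2 + (h ^ 2 * p.M i) * (x.1 i - δ₀ i) ^ 2 := by ring
        _ ≤ p.M i * x.2 i ^ 2 + (h * p.D i / 2) * (x.1 i - δ₀ i) ^ 2 := by
            linarith [mul_le_mul_of_nonneg_right hhM2 hφ2]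
        _ = p.M i * x.2 i ^ 2 + (h / 2) * (p.D i * (x.1 i - δ₀ i) ^ 2) := by ring
    have hsum := Finset.sum_le_sum hterm
    rw [← Finset.mul_sum, Finset.sum_add_distrib, ← Finset.mul_sum] at hsum
    have hK : ∑ i ∈ p.gen, p.M i * x.2 i ^ 2 = 2 * p.kinetic x.2 := by
      unfold Params.kinetic; ring
    rw [hK] at hsum
    exact hsum
  -- restrict/extend sums over gen to all buses
  have hgenall : ∑ i ∈ p.gen, p.D i * (x.1 i - δ₀ i) ^ 2 ≤ ∑ i, p.D i * (x.1 i - δ₀ i) ^ 2 :=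
    Finset.sum_le_sum_of_subset_of_nonneg (Finset.subset_univ _)
      fun i _ _ => mul_nonneg (hp.D_pos i).le (sq_nonneg _)
  have hT2 : (1 / 2) * h * ∑ i, (p.D i - h * p.M i) * (x.1 i - δ₀ i) ^ 2
      ≤ (h / 2) * ∑ i, p.D i * (x.1 i - δ₀ i) ^ 2 := by
    have hle : ∑ i, (p.D i - h * p.M i) * (x.1 i - δ₀ i) ^ 2 ≤ ∑ i, p.D i * (x.1 i - δ₀ i) ^ 2 := by
      refine Finset.sum_le_sum fun i _ => mul_le_mul_of_nonneg_right ?_ (sq_nonneg _)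
      have hM0 : 0 ≤ p.M i := by
        by_cases hi : i ∈ p.gen
        · exact (hp.M_pos i hi).le
        · rw [hp.M_eq_zero i hi]
      nlinarith
    have := mul_le_mul_of_nonneg_left hle (show 0 ≤ h / 2 by linarith)
    linarith
  have hΦ0 : 0 ≤ ∑ i, p.D i * (x.1 i - δ₀ i) ^ 2 :=
    Finset.sum_nonneg fun i _ => mul_nonneg (hp.D_pos i).le (sq_nonneg _)
  nlinarith

/-! ### The closed-form rate and the pointwise inequality `V̇_h ≤ −ρ·V_h` -/

/-- **The closed-form synchronisation rate** of the strict Lyapunov function `V_h` for MODEL MV-3: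
`vhRate p β θ h = min{ h/(1 + h·Σ_gen M/ΣD), 2h·g(θ)/(1 + 4h·n²·ΣD/β) }`, `g(θ) = (1 − sin θ)/(π/2 − θ)`
— data only (inertias, dampings, a coupling lower bound `β` on the edges, the equilibrium line-angle
bound `θ`, the cross-term weight `h`); no solver, no matrix inverse. A certified LOWER bound on the
decay rate of `V_h` in the model (`fderiv_vh_le_neg_vhRate_mul`), small on large networks because of
the `n²` walk constant; not a damping figure of any grid. [folklore] -/
def vhRate (p : Params n) (β θ h : ℝ) : ℝ :=
  min (h / (1 + h * (∑ i ∈ p.gen, p.M i) / (∑ i, p.D i)))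
    (2 * h * ((1 - Real.sin θ) / (π / 2 - θ)) / (1 + 4 * h * (n : ℝ) ^ 2 * (∑ i, p.D i) / β))

/-- The rate is positive for well-formed data on `n ≠ 0` buses, `β > 0`, `0 ≤ θ < π/2`, `h > 0`.
[folklore] -/
theorem vhRate_pos {p : Params n} (hp : p.WellFormed) (hn : n ≠ 0) {β θ h : ℝ} (hβ : 0 < β)
    (hθ0 : 0 ≤ θ) (hθ : θ < π / 2) (hh : 0 < h) : 0 < vhRate p β θ h := by
  have hSD : 0 < ∑ i, p.D i := sum_D_pos hp hn
  have hSM : 0 ≤ ∑ i ∈ p.gen, p.M i := Finset.sum_nonneg fun i hi => (hp.M_pos i hi).le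
  have hg : 0 < (1 - Real.sin θ) / (π / 2 - θ) := SinusoidalCoupling.sectorGain_pos hθ0 hθ
  unfold vhRate
  refine lt_min ?_ ?_
  · have : 0 < 1 + h * (∑ i ∈ p.gen, p.M i) / ∑ i, p.D i := by positivity
    positivity
  · have : 0 < 1 + 4 * h * (n : ℝ) ^ 2 * (∑ i, p.D i) / β := by positivity
    positivity

/-- **The pointwise exponential-rate inequality `V̇_h ≤ −ρ·V_h` (solver-free, every `n`, every coupling
graph, every damping pattern).** DATA: well-formed structure-preserving data `p` on `n ≠ 0` buses,
susceptive couplings `bᵢⱼ ≥ 0` with `bᵢⱼ ≥ β > 0` on the edges of a PRECONNECTED coupling graph, a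
synchronous equilibrium `δ₀` of the shifted model with line angles `|δ₀ᵢ − δ₀ⱼ| ≤ θ` (`0 ≤ θ < π/2`) on
coupled pairs, and a cross-term weight `h > 0` with `2hMᵢ ≤ Dᵢ` on the generators. CLAIM: at every phase
point `x = (δ, ω)` on the momentum leaf `constraintSet p δ₀` with every coupled line angle in the closed
window `|δᵢ − δⱼ| ≤ π/2`,
`D(V + hX)(x)·F(x) ≤ −vhRate p β θ h · (V + hX)(x)`.
Proof: `V̇_h = −Σ_load Dδ̇² − Σ_gen(D − hM)ω² − hΠ ≤ −2hK − 2h·g(θ)·Q` (`vh_rate_eq`, `D − hM ≥ hM`,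
`pairing_ge_quadratic`), while `V_h ≤ 2K + hΦ + Q ≤ (2 + 2h·SM/SD)K + (1 + 4h·n²·SD/β)Q`
(`vh_le_of_two_mul_le`, `sum_D_sq_le_of_mem_constraintSet`). MODEL MV-3; no sentence here says a grid is
stable or well damped. [cite: Khalil2002, Theorem 4.10 (hypothesis (4.26) in the form V̇ ≤ −(k₃/k₂)V)] -/
theorem fderiv_vh_le_neg_vhRate_mul {p : Params n} (hp : p.WellFormed) (hn : n ≠ 0)
    (hconn : p.couplingGraph.Preconnected) (hb : ∀ i j, 0 ≤ p.b i j) {β : ℝ} (hβ : 0 < β)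
    (hβb : ∀ i j, p.couplingGraph.Adj i j → β ≤ p.b i j)
    {δ₀ : Fin n → ℝ} {θ : ℝ} (hθ0 : 0 ≤ θ) (hθ : θ < π / 2)
    (h0 : ∀ i j, p.b i j ≠ 0 → |δ₀ i - δ₀ j| ≤ θ) (hδ₀ : p.IsSyncEquilibrium δ₀)
    {h : ℝ} (hh : 0 < h) (hhM : ∀ i ∈ p.gen, 2 * h * p.M i ≤ p.D i)
    {x : (Fin n → ℝ) × (Fin n → ℝ)} (hx : x ∈ constraintSet p δ₀)
    (hP : ∀ i j, p.b i j ≠ 0 → |x.1 i - x.1 j| ≤ π / 2) :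
    fderiv ℝ (fun y => phaseEnergy p δ₀ y + h * crossTerm p δ₀ y) x (phaseField p x)
      ≤ -vhRate p β θ h * (phaseEnergy p δ₀ x + h * crossTerm p δ₀ x) := by
  set gθ := (1 - Real.sin θ) / (π / 2 - θ) with hgθ
  set SD : ℝ := ∑ i, p.D i with hSD
  set SM : ℝ := ∑ i ∈ p.gen, p.M i with hSM
  set K : ℝ := p.kinetic x.2 with hK
  set Qx : ℝ := (1 / 2) * ∑ i, ∑ j, p.b i j * (((x.1 i - x.1 j) - (δ₀ i - δ₀ j)) ^ 2 / 2)
    with hQx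
  set Φ : ℝ := ∑ i, p.D i * (x.1 i - δ₀ i) ^ 2 with hΦ
  set ρ := vhRate p β θ h with hρ
  have hSDpos : 0 < SD := sum_D_pos hp hn
  have hSM0 : 0 ≤ SM := Finset.sum_nonneg fun i hi => (hp.M_pos i hi).le
  have hg : 0 < gθ := SinusoidalCoupling.sectorGain_pos hθ0 hθ
  have hK0 : 0 ≤ K := p.kinetic_nonneg (fun i hi => (hp.M_pos i hi).le) x.2
  have hQ0 : 0 ≤ Qx := p.quadraticGap_nonneg hb δ₀ x.1
  -- (1) dissipation: V̇_h ≤ −2hK − 2h·g·Q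
  have hdiss : fderiv ℝ (fun y => phaseEnergy p δ₀ y + h * crossTerm p δ₀ y) x (phaseField p x)
      ≤ -(2 * h * K) - 2 * h * gθ * Qx := by
    rw [fderiv_vh_phaseField hp hδ₀ h x, vh_rate_eq x δ₀ h]
    have h1 : 0 ≤ ∑ i ∈ univ \ p.gen, p.D i * (phaseField p x).1 i ^ 2 :=
      Finset.sum_nonneg fun i _ => mul_nonneg (hp.D_pos i).le (sq_nonneg _)
    have h2 : 2 * h * K ≤ ∑ i ∈ p.gen, (p.D i - h * p.M i) * x.2 i ^ 2 := by
      have hK2 : 2 * h * K = ∑ i ∈ p.gen, h * p.M i * x.2 i ^ 2 := by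
        rw [hK]; unfold Params.kinetic
        rw [Finset.mul_sum, Finset.mul_sum]
        exact Finset.sum_congr rfl fun i _ => by ring
      rw [hK2]
      refine Finset.sum_le_sum fun i hi => mul_le_mul_of_nonneg_right ?_ (sq_nonneg _)
      linarith [hhM i hi]
    have h3 : 2 * gθ * Qx ≤ pairing p δ₀ x.1 := pairing_ge_quadratic p hb hθ h0 hP
    nlinarith
  -- (2) upper bound: V_h ≤ (2 + 2h·SM/SD)K + (1 + 4h·n²·SD/β)Q
  have hup : phaseEnergy p δ₀ x + h * crossTerm p δ₀ x
      ≤ (2 + 2 * h * SM / SD) * K + (1 + 4 * h * (n : ℝ) ^ 2 * SD / β) * Qx := by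
    have hA := vh_le_of_two_mul_le hp hb δ₀ hh.le hhM x
    have hB := sum_D_sq_le_of_mem_constraintSet hp hn hconn hb hβ hβb hx
    rw [← hK, ← hΦ, ← hQx] at hA
    rw [← hΦ, ← hQx, ← hSD, ← hSM] at hB
    have hB' := mul_le_mul_of_nonneg_left hB hh.le
    have : h * (4 * (n : ℝ) ^ 2 * SD / β * Qx + 2 * SM / SD * K)
        = (2 * h * SM / SD) * K + (4 * h * (n : ℝ) ^ 2 * SD / β) * Qx := by ring
    rw [this] at hB'
    linarith
  -- (3) the rate constants
  have hρ1 : ρ * (2 + 2 * h * SM / SD) ≤ 2 * h := by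
    have hden : 0 < 1 + h * SM / SD := by positivity
    have hle : ρ ≤ h / (1 + h * SM / SD) := by
      rw [hρ]; unfold vhRate; rw [← hSD, ← hSM]; exact min_le_left _ _
    have := mul_le_mul_of_nonneg_right hle (show 0 ≤ 2 + 2 * h * SM / SD by positivity)
    have heq : h / (1 + h * SM / SD) * (2 + 2 * h * SM / SD) = 2 * h := by
      have e : 2 + 2 * h * SM / SD = 2 * (1 + h * SM / SD) := by ring
      rw [e]
      field_simp
    linarith
  have hρ2 : ρ * (1 + 4 * h * (n : ℝ) ^ 2 * SD / β) ≤ 2 * h * gθ := by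
    have hden : 0 < 1 + 4 * h * (n : ℝ) ^ 2 * SD / β := by positivity
    have hle : ρ ≤ 2 * h * gθ / (1 + 4 * h * (n : ℝ) ^ 2 * SD / β) := by
      rw [hρ]; unfold vhRate; rw [← hSD, ← hgθ]; exact min_le_right _ _
    have := mul_le_mul_of_nonneg_right hle hden.le
    have heq : 2 * h * gθ / (1 + 4 * h * (n : ℝ) ^ 2 * SD / β)
        * (1 + 4 * h * (n : ℝ) ^ 2 * SD / β) = 2 * h * gθ := by
      field_simp
    linarith
  -- (4) combine
  have hρ0 : 0 ≤ ρ := (vhRate_pos hp hn hβ hθ0 hθ hh).le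
  have hfin : ρ * (phaseEnergy p δ₀ x + h * crossTerm p δ₀ x) ≤ 2 * h * K + 2 * h * gθ * Qx := by
    have := mul_le_mul_of_nonneg_left hup hρ0
    have e : ρ * ((2 + 2 * h * SM / SD) * K + (1 + 4 * h * (n : ℝ) ^ 2 * SD / β) * Qx)
        = (ρ * (2 + 2 * h * SM / SD)) * K + (ρ * (1 + 4 * h * (n : ℝ) ^ 2 * SD / β)) * Qx := by
      ring
    rw [e] at this
    nlinarith [mul_le_mul_of_nonneg_right hρ1 hK0, mul_le_mul_of_nonneg_right hρ2 hQ0]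
  linarith

end Summit.Ventures.GridStability.Lyapunov.StructurePreserving

end
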